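import Literature.AlgebraicGeometry.Motives.AbelianVarietyProduct
import Literature.AlgebraicGeometry.Motives.HyperbolicWeilType
import Literature.AlgebraicGeometry.HodgeTheory.RationalHodgeClasses
import Literature.AlgebraicGeometry.HodgeTheory.AlgebraicClasses
import HarnessLib
import Literature.AlgebraicGeometry.HodgeTheory.ComplexConjugationHolds
import Literature.AlgebraicGeometry.HodgeTheory.AlgebraicClassesCupAbelianVariety
import Literature.AlgebraicGeometry.HodgeTheory.HodgeTypePullback
import Literature.AlgebraicGeometry.HodgeTheory.CupPreservesHodgeTypeOfDeRham
import Literature.AlgebraicGeometry.HodgeTheory.HodgeFiltrationModelsReductionProofs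
import Literature.AlgebraicGeometry.Motives.ComplexPointsOrientation
import Literature.AlgebraicGeometry.Motives.AbelianVarietyProductDimProofs

/-!
# Aimed split products with the CM Weil surface (the aiming lemma of the product trick)

Family `hodge`, layer `Literature/AlgebraicGeometry/Motives`. ONE NAMED FACT (D-0014), no proof, and
ONE RETIRED (refuted) record:

* `exists_cmWeilSurface_aimedSplitProduct` — **REFUTED AS STATED; retired from literature debt
  (verdict clean-up 2026-08-16).** It is false at `d ∈ {1, 3}` (see `## Misstatement` below), and its
  negation is the kernel-checked theorem
  `Motives.not_exists_cmWeilSurface_aimedSplitProduct : ¬ exists_cmWeilSurface_aimedSplitProduct`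
  (`Motives/AimedSplitProductRefutation`, p115551; witness `d = 3`, `n = 2`). The `def` is kept with
  its statement byte-for-byte ONLY because that refutation (and, as a vacuous hypothesis, two
  Summits-side Theorems files) name it; it carries `@[deprecated]`, no
  `exists_cmWeilSurface_aimedSplitProduct_holds` can exist, nobody may consume it. Its in-file
  corollaries `exists_cmWeilSurface_aimedSplitProduct.at`, `.of_ne_one_of_ne_three` and
  `exists_cmWeilSurface_aimedSplitProduct_of_ne_one_of_ne_three.of_unguarded` (whose hypothesis IS
  the refuted record, hence vacuous) are deprecated with it;
* `exists_cmWeilSurface_aimedSplitProduct_of_ne_one_of_ne_three` — **the CORRECTED statement, the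
  one to consume** (the original under the guard `d ≠ 1 → d ≠ 3 →`, the regime in which the typing
  expresses Weil type; filed 2026-08-16, relocated into this file by the gate, second part of the
  file). This is the fact to consume and, eventually, to discharge; review-split verdict
  (2026-08-16): the misstated child is RESTATED as this fact, not merged and not split further.

Proved here: the eigenvalue collisions `weilTestCharacter_collision_three/one` (and the "balanced"
collisions `weilTestCharacter_collision_three_balanced/one_balanced` behind the simplest
counterexamples) that cause the misstatement; `weilTestCharacter_pow_ne_pow` (there are no other
collisions: `(1-i√d)/(1+i√d)` is a root of unity only for `d ∈ {1, 3}`); the (deprecated, vacuous)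
specialisation `exists_cmWeilSurface_aimedSplitProduct.of_ne_one_of_ne_three` (original ⇒ corrected,
whose CONCLUSION is the corrected statement verbatim) and its bundled form
`exists_cmWeilSurface_aimedSplitProduct_of_ne_one_of_ne_three.of_unguarded`.

The PRODUCT TRICK of C. Schoen (Compositio Math. 114 (1998), Addendum §10), K. Koike (Canad. Math.
Bull. 47 (2004)) and E. Markman (arXiv:2509.23403 §11.5 Step 2; arXiv:2502.03415 proof of Cor. 1.6.1)
derives the algebraicity of the Hodge–Weil classes of a polarized abelian `2n`-fold `(A, K, h_A)` of
Weil type and ARBITRARY discriminant from the algebraicity of the Hodge–Weil classes on the SPLIT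
(hyperbolic, discriminant `(-1)^{n+1}`) component one dimension up, through the product with a CM
Weil SURFACE `B = E × E` (`E = ℂ/O_K`, `K` acting through `(ι, ῑ)`, Weil type `(1,1)`): the
discriminant is multiplicative under products (van Geemen, LNM 1594, Lemma 5.2 (3)), every class
`-q`, `q ∈ ℚ_{>0}`, is the discriminant of a `K`-compatible polarization `m₁E₁ ⊕ m₂E₁` of `E × E`
(loc. cit. 5.3), and a form of signature `(n+1, n+1)` and discriminant `(-1)^{n+1}` is hyperbolic
(Landherr; loc. cit. 5.4 (5.4.1)). Markman, verbatim (§11.5 Step 2, for fourfolds): "for every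
polarized abelian fourfold `(A₁,η₁,h₁)` of Weil type, of arbitrary discriminant, there exists a
polarized abelian surface of Weil type `(A₂,η₂,h₂)`, such that the discriminant of their product
polarized abelian sixfold of Weil type `(A₁ × A₂, η, π₁^*h₁ + π₂^*h₂)` is the coset of `-1`. The
sixfold is hence of split type". The descent itself then uses a DESCENT PAIR on `B` (Schoen §10:
"`W_{A'}` is generated by cohomology classes of divisors" and "`ω_{5,σ₁} ∧ ω_{6,σ₁} ∧ ω_{5,σ₂} ∧ ω_{6,σ₂}`
is a basis for `H⁴(A'; ℂ)`").

This file states the AIMING half of the trick on the tree's real carriers, in the polarised typing of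
the Hodge summit's route `HeckePrymWeil` (decls `HyperbolicEightfoldsSqrtMinus7`, `AimedDescending`):
the existence of ONE surface `(B, ψ)` with a descent pair such that for every Weil-type `(A, φ)` of
every even dimension the product `A × B` has a projective embedding whose `K`-symmetrised hyperplane
class `d·ι^*a + (φ × ψ)^*ι^*a` makes `(A × B, φ × ψ)` of hyperbolic Weil type
(`Motives.IsHyperbolicWeilType`, a rational `(φ×ψ)^*`-stable Lagrangian frame of `H¹` for the
polarization pairing `h^{2n+1} ⌣ · ⌣ ·`; dictionary (1)–(4) of `Motives/HyperbolicWeilType`).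
"Weil type" of `(A, φ)` is witnessed, as the route's statements supply it, by a non-zero rational
`(n,n)`-class in the Weil span `Eig((𝟙+φ)^*, (1+i√d)^{2n}) ⊔ Eig((𝟙+φ)^*, (1-i√d)^{2n})` (such a
class exists iff the `K`-multiplicities are `(n, n)`).

## Misstatement of `exists_cmWeilSurface_aimedSplitProduct` (recorded 2026-08-16)

"Weil type" of `(A, φ)` is rendered in this file (as in the route decls it serves) by ONE test
endomorphism: a class in `Eig((𝟙+φ)^*, (1+i√d)^{2n}) ⊔ Eig((𝟙+φ)^*, (1-i√d)^{2n}) ⊆ H^{2n}(A(ℂ); ℂ)`.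
On the summand `⋀ᵃV₊ ⊗ ⋀ᵇV₋` of `H^{2n} = ⋀^{2n}H¹` (`V±` the `±i√d`-eigenspaces of `φ^*` on `H¹`,
`a + b = 2n`) `(𝟙+φ)^*` acts by `(1+i√d)ᵃ(1-i√d)ᵇ`, which collides with `(1+i√d)^{2n}` iff `ζᵇ = 1`,
`ζ = (1-i√d)/(1+i√d) = ((1-d) - 2i√d)/(1+d)`. Now `ζ` is a root of unity iff `d = 1` (`ζ = -i`,
order `4`) or `d = 3` (`ζ = e^{-2πi/3}`, order `3`): the roots of unity of an imaginary quadratic field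
are `±1, ±i, ±ω^{±1}`. So for `d ∉ {1, 3}` the two eigenspaces ARE the Weil lines `⋀^{2n}V±` and a
non-zero rational `(n,n)`-class in their span exists iff the `K`-multiplicities are `(n, n)` (van
Geemen 5.2 (6)); this is why the route decls (`HeckePrymWeil.AimedDescending`,
`HyperbolicEightfoldsSqrtMinus7`, …) carry `p.Prime → p % 4 = 3 → 7 ≤ p`. But for `d = 3, 2n ≥ 4`
(`weilTestCharacter_collision_three`: `(1+i√3)(1-i√3)³ = (1+i√3)⁴`) and `d = 1, 2n ≥ 6`
(`weilTestCharacter_collision_one`: `(1+i)²(1-i)⁴ = (1+i)⁶`) the span is strictly larger and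
contains non-zero rational ALGEBRAIC `(n,n)`-classes on abelian varieties NOT of Weil type: for
`d = 3`, `A = E⁴`, `E = ℂ/ℤ[ω]`, `φ = (√-3, √-3, √-3, -√-3)` (multiplicities `(3,1)`),
`c = pr₁^*[pt] ⌣ pr₂₄^*([Δ] - [pt × E] - [E × pt]) ∝ dz₁dz̄₁dz₂dz̄₄ + dz₁dz̄₁dz₄dz̄₂ ≠ 0`, whose
two monomials lie in `⋀³V₊ ⊗ V₋ ⊆ Eig₋` and `V₊ ⊗ ⋀³V₋ ⊆ Eig₊`; for `d = 1`, `A = E⁶`, `E = ℂ/ℤ[i]`,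
`φ = (i,i,i,i,-i,-i)`, `c = pr₁^*[pt] ⌣ pr₅^*[pt] ⌣ pr₂₆^*([Δ] - [pt × E] - [E × pt])`. For such
`(A, ±φ)` and ANY surface `(B, ψ)` one of the products `A × B` has unbalanced `K`-multiplicities
`(p', q')`, `p' ≠ q'`; its `K`-symmetrised hyperplane class `d·h + (φ×ψ)^*h` is `a₀ · H'`,
`a₀ ∈ ℚ^×`, `H' = d·h_e + (φ×ψ)^*h_e` the class of an ample `K`-compatible polarization (`h_e` the
hyperplane class of `e`), whose Hermitian form has signature `(p', q')` (van Geemen, proof of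
Lemma 5.2 (4)–(5)) and hence NO totally isotropic `K`-subspace of dimension `n + 1 > min(p', q')`,
while `IsHyperbolicWeilType (A.prod B) (φ × ψ) (n+1) _` asserts one (dictionary (1)–(4) of
`Motives/HyperbolicWeilType`; `Q_h` is non-degenerate on `H¹` by hard Lefschetz). Hence the inner
`∀ n A φ` of `exists_cmWeilSurface_aimedSplitProduct` fails at `(d, n) = (3, 2)` and `(1, 3)` for every
`(B, ψ)`: the fact is false at `d = 1` and `d = 3`, true (= the printed product trick) for every other
`d`. The corrected statement adds exactly the guard `d ≠ 1 → d ≠ 3 →` (spelled out as the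
conclusion of `exists_cmWeilSurface_aimedSplitProduct.of_ne_one_of_ne_three`, and filed as the named
fact `exists_cmWeilSurface_aimedSplitProduct_of_ne_one_of_ne_three`, second part of this file); it
covers every use in the tree (`d = p ≥ 7`). General form for all `d`: render Weil type by `c ∈ HodgeTheory.weilClassesOf A φ n d`
(simultaneous eigenclasses of all `(x·𝟙 + y·φ)^*`, `HodgeTheory/WeilClasses`, whose characters never
collide).

Simplest counterexamples (review-split seat, 2026-08-16; no diagonal class is needed). The test
eigenvalue `(1+i√d)^{2n}` is a RATIONAL INTEGER exactly when `ζⁿ = 1`, and then the balanced summand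
`⋀ⁿV₊ ⊗ ⋀ⁿV₋`, on which `(𝟙+φ)^*` acts by `(1+d)ⁿ`, collides with the Weil line:
`(1+i√3)³(1-i√3)³ = 4³ = (1+i√3)⁶` (`d = 3`, `n = 3`; `weilTestCharacter_collision_three_balanced`)
and `(1+i)⁴(1-i)⁴ = 2⁴ = (1+i)⁸` (`d = 1`, `n = 4`; `weilTestCharacter_collision_one_balanced`). Take
`E = E_ω = ℂ/ℤ[ω]` with `ρ = [√-3] = [2ω + 1]`, `ρ ≫ ρ = -3` (in the tree: `HodgeTheory.WeilSquare.rho`,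
`WeilSquare.rho_comp_rho`, file `HodgeTheory/EisensteinCurveSqrtMinusThree`; `ρ` acts on the
uniformisation by `z ↦ i√3·z`, so `ρ^* = i√3` on `H^{1,0}(E)`), `A = E⁶` and `φ = ρ^{×6}` —
`K`-multiplicities `(6, 0)`, as far from Weil type as possible. Since `𝟙 + φ = (𝟙 + ρ)^{×6}` and
`(𝟙 + ρ)^*` is multiplication by `deg (𝟙 + ρ) = Nm(1 + √-3) = 4` on `H²(E(ℂ); ℚ) ≅ ℚ`, EVERY product
class `c = pr₁^*ω ⌣ pr₂^*ω ⌣ pr₃^*ω` (`ω` the point class of `E`; `c` is the class of `pt³ × E³`: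
rational, algebraic, of Hodge type `(3,3)`, non-zero by Künneth) has `(𝟙+φ)^*c = 4³·c = (1+i√3)⁶·c`,
i.e. lies in `Eig((𝟙+φ)^*, (1+i√3)⁶)`: the hypothesis of the inner `∀` holds at `(d, n) = (3, 3)` for
an `(A, φ)` that is not of Weil type (and for `(A, -φ)` alike). For `d = 1`: `E = ℂ/ℤ[i]`, `ρ = [i]`,
`A = E⁸`, `φ = ρ^{×8}` (multiplicities `(8, 0)`), `c = [pt⁴ × E⁴]`, `(𝟙+φ)^*c = 2⁴·c = (1+i)⁸·c` at
`(d, n) = (1, 4)`. For these `A` and ANY admissible `(B, ψ)` the product `A × B` has multiplicities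
`(2n + m₊, m₋)` with `m₋ ≤ 2 < n + 1`, and the signature argument of the previous paragraph (van
Geemen, proof of Lemma 5.2 (4)–(5): the Hermitian form of a `K`-compatible polarization is definite
on each `K`-eigenspace of `T₀`, so its Witt index is `min` of the multiplicities — this holds for
every `(X, K ⊂ End⁰ X)`, Weil type or not) shows that NO `K`-symmetrised hyperplane class
`d·h + (φ×ψ)^*h` of `A × B` is of hyperbolic Weil type in half-dimension `n + 1`.

The formal refutation (landed 2026-08-16, p115551):
`Motives.not_exists_cmWeilSurface_aimedSplitProduct : ¬ exists_cmWeilSurface_aimedSplitProduct`,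
file `Motives/AimedSplitProductRefutation`, axioms `propext`, `Classical.choice`, `Quot.sound` only.
It instantiates the fact at `d = 3`, `n = 2` with the smallest unbalanced witness
`A = E_ω × (E_ω × E_ω) × E_ω`, `φ = ρ × (ρ × (-ρ)) × ρ` (`K`-multiplicities `(3, 1)` up to the
orientation of `ρ`; `EisensteinCounterexample.phiOf`, the hypothesis class being
`EisensteinCounterexample.exists_singleTest_weilSpan_class` of
`Motives/AimedSplitProductCounterexampleClass`, the `(2,2)`-instance of the collision
`weilTestCharacter_collision_three` below). On the conclusion side the failure IS the positivity of a
polarization, now in the tree on the carriers: the pulled-back hyperplane class is a real multiple of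
a Kähler class (`HodgeTheory.exists_real_map_eq_smul_of_pullback_eq_fubiniStudy`,
`HodgeTheory/HyperplaneClassLine`), Hodge–Riemann in degree one
(`HodgeTheory.IsKaehlerClass.hodgeRiemann_one_smul`, `HodgeTheory/HodgeRiemannDegreeOne`) bounds a
real `(φ×ψ)^*`-stable `Q_h`-isotropic subspace of `H¹` by `2 · min (p, q)` for the multiplicities
`(p, q)` of `i√3` on `H^{1,0} ⊕ H^{0,1}` of `A × B` (`HodgeTheory.finrank_le_two_mul_min`,
`HodgeTheory/WeilTypeSignatureBound` — van Geemen's Lemma 5.2 (1), (4)–(5) read backwards), the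
descent pair forces `(B, ψ)` to have multiplicities `(1, 1)`
(`HodgeTheory.finrank_eigenspace_inf_hodge_eq_one_of_testClasses`,
`HodgeTheory/WeilSurfaceTestClassMultiplicities`), so `(p, q) ∈ {(4, 2), (2, 4)}` and the rational
Lagrangian `6`-frame the fact asserts would give `6 ≤ 4`.

## Why the corrected fact is not proved here (state of the tree, 2026-08-16)

The surface conjunct is PROVED for every `d` with a non-CM model `(E × E, ψ = (-(d • snd), fst))`
(`Motives.exists_weilSurface_descentPair`, file `Motives/AimedSplitProductProofs`), which however
cannot serve the aiming half (its `K`-compatible Néron–Severi classes realise a single discriminant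
class; loc. cit., CAVEAT); the printed CM surface `E × E`, `E = ℂ/O_K`, exists in the tree so far only
for `d = 3` (`HodgeTheory/EisensteinCurveSqrtMinusThree`) — for `d ≠ 1, 3` the algebraic
endomorphism `[√-d]` of the Weierstrass model of `ℂ/O_K` is not constructed. The aiming half
quantifies over an ARBITRARY `A : AbelianVariety ℂ`; of its dictionary the tree now HAS
`dim H¹(A(ℂ); ℂ) = 2 dim A` and `H^• = ⋀^•H¹` (`Motives.abelianVarietyCohomologyExteriorH1_holds`), the
transport of a rational degree-one model to a hyperbolic frame
(`Motives/HyperbolicWeilTypeOfRationalModel`, `Motives/HyperbolicWeilTypeProduct`) and the arithmetic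
core (Landherr via Meyer: `Motives/WeilHermitianSplitting`, `Motives/WeilFormIsotropicExtension`); it
LACKS the Riemann form of a polarization on `H₁(A(ℂ), ℚ)` with its positivity (equivalently the
Hodge–Riemann relation in degree one on the carriers), Lefschetz's embedding theorem with the
hyperplane-class calculus `e.ι^*[H] = c₁(L^{⊗3})` on `complexBetti`, and hard Lefschetz in degree
one (`Q_h` non-degenerate), which identify `Q_h = c·E^*·vol` (dictionary (3) of
`Motives/HyperbolicWeilType`). Size XL (a theory), not a split candidate (D-0027).

## References

* [Markman2025SurveySecant] E. Markman, Secant sheaves and Weil classes on abelian varieties,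
  arXiv:2509.23403, §11.5 Step 2.
* [vanGeemen1994HodgeAV] B. van Geemen, An introduction to the Hodge conjecture for abelian
  varieties, LNM 1594 (1994), Def. 4.9, Lemma 5.2 (2)–(6) and its proof (pp. 220–222), 5.3–5.8,
  5.4 (5.4.1).
* [Schoen1998HodgeWeilAddendum] C. Schoen, Addendum to: Hodge classes on self-products of a variety
  with an automorphism, Compositio Math. 114 (1998), §10.
-/

noncomputable section

open CategoryTheory
open Literature.AlgebraicTopology.SingularHomology Literature.AlgebraicGeometry.HodgeTheory

namespace Literature.AlgebraicGeometry.Motives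

/-- **REFUTED AS STATED — retired from literature debt (verdict clean-up 2026-08-16); deprecated,
do not consume.** **What is wrong:** "of Weil type" (van Geemen, Def. 4.9: every `x ∈ K` acts on
`T₀A` with multiplicities `(n, n)`) is rendered below by ONE test endomorphism — a non-zero rational
`(n,n)`-class in `Eig((𝟙+φ)^*, (1+i√d)^{2n}) ⊔ Eig((𝟙+φ)^*, (1-i√d)^{2n})` — and for `d ∈ {1, 3}`
that span is strictly larger than the two Weil lines (eigenvalue collisions
`weilTestCharacter_collision_three/one`, module docstring `## Misstatement`), so the inner `∀ A φ`
ranges over abelian varieties that are NOT of Weil type, for which no product `A × B` is of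
hyperbolic Weil type. **Refutation (kernel-checked, kept):**
`Literature.AlgebraicGeometry.Motives.not_exists_cmWeilSurface_aimedSplitProduct :
¬ exists_cmWeilSurface_aimedSplitProduct` (`Literature/AlgebraicGeometry/Motives/AimedSplitProductRefutation.lean`,
p115551; witness `d = 3`, `n = 2`, `A = E_ω × (E_ω × E_ω) × E_ω`, `φ = ρ × (ρ × (-ρ)) × ρ`, via
Hodge–Riemann in degree one). **Corrected statement — use instead:** the named fact
`Literature.AlgebraicGeometry.Motives.exists_cmWeilSurface_aimedSplitProduct_of_ne_one_of_ne_three`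
(second part of this file: this statement verbatim under the guard `d ≠ 1 → d ≠ 3 →`, the regime in
which the single-test typing expresses Weil type, `weilTestCharacter_eq_pow_add_iff_right/left`; it
covers every use in the tree, `d = p ≥ 7`). The `def` below is kept with its statement byte-for-byte
only because its refutation (and, as a vacuous hypothesis, the Summits-side Theorems files
`HeckePrymWeilWeilSixfoldsSqrtMinus7AimedDescendingOfFacts`,
`HeckePrymWeilWeilSixfoldsSqrtMinus7OfHyperbolicEightfolds`) name it; no
`exists_cmWeilSurface_aimedSplitProduct_holds` can exist.
**The record (original docstring).** **Aimed split products with the CM Weil surface (the aiming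
lemma of the product trick, in the polarised carrier typing).** For every `d > 0` (`K = ℚ(√-d)`)
there is a complex abelian SURFACE `B`
with an endomorphism `ψ`, `ψ ≫ ψ = -d` — in print `B = E × E`, `E = ℂ/O_K`, `K` acting through
`(ι, ῑ)`, of Weil type `(1,1)` — carrying a DESCENT PAIR: classes `b₊ ∈ Eig((𝟙+ψ)^*, (1+i√d)²)`,
`b₋ ∈ Eig((𝟙+ψ)^*, (1-i√d)²)` in `H²(B(ℂ); ℂ)` with `b₊ + b₋` rational of Hodge type `(1,1)` and an
algebraic class `η ∈ N¹H²(B(ℂ); ℂ)` with `b₊ ⌣ η ≠ 0`, `b₋ ⌣ η ≠ 0` in `H⁴(B(ℂ); ℂ)` (Schoen: "`W_{A'}`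
is generated by cohomology classes of divisors" and "`ω_{5,σ₁} ∧ ω_{6,σ₁} ∧ ω_{5,σ₂} ∧ ω_{6,σ₂}` is a
basis for `H⁴(A'; ℂ)`"), such that for every `n` and every complex abelian `2n`-fold `(A, φ)` with
`φ ≫ φ = -d` which is of Weil type — witnessed by a non-zero rational `(n,n)`-class in its Weil span
`Eig((𝟙+φ)^*, (1+i√d)^{2n}) ⊔ Eig((𝟙+φ)^*, (1-i√d)^{2n})` — the product `A × B` has a projective
embedding `e` and a rational class `a ≠ 0` of `H²(ℙᴺ(ℂ); ℂ)` for which `(A × B, φ × ψ)` is of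
HYPERBOLIC (split) Weil type in half-dimension `n + 1` for the `K`-symmetrised hyperplane class
`d·e.ι^*a + (φ × ψ)^*e.ι^*a` (`IsHyperbolicWeilType`: a `(φ×ψ)^*`-stable rational Lagrangian
`(2n+2)`-frame of `H¹`, i.e. Witt index `n + 1`, `det H = (-1)^{n+1} ∈ ℚ^×/Nm(K^×)`). Printed for
fourfolds `A` by Markman ("for every polarized abelian fourfold `(A₁,η₁,h₁)` of Weil type, of
arbitrary discriminant, there exists a polarized abelian surface of Weil type `(A₂,η₂,h₂)`, such that
the discriminant of their product polarized abelian sixfold of Weil type `(A₁ × A₂, η, π₁^*h₁ + π₂^*h₂)`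
is the coset of `-1`. The sixfold is hence of split type"); in every dimension it is van Geemen's
Lemma 5.2 (3) (`det H` is multiplicative under orthogonal sums), 5.3 (on `E × E` every class `-q`,
`q ∈ ℚ_{>0}`, is the discriminant of a `K`-compatible polarisation `m₁E₁ ⊕ m₂E₁`) and 5.4 (5.4.1)
(Landherr: signature `(n+1, n+1)` and `det H = (-1)^{n+1}` force Witt index `n + 1`), read through the
dictionary `Q_h = c·E^*·vol` on `H* = ⋀*H¹` of `Motives/HyperbolicWeilType`; the embedding is
Segre ∘ (an embedding of `A` × Veronese-weighted embeddings of the two factors of `B`).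
-- TODO(general form): any imaginary quadratic `K` and any CM elliptic curve `E` with `O_K ⊆ End E`;
-- the surface may be replaced by any Weil surface whose `K`-compatible Néron–Severi classes realise
-- every discriminant.
[cite: Markman2025SurveySecant, §11.5 Step 2] [cite: vanGeemen1994HodgeAV, Def. 4.9, Lemma 5.2 (3), 5.3 and 5.4 (5.4.1)]
[cite: Schoen1998HodgeWeilAddendum, §10 (proof of the Proposition)] -/
@[deprecated "refuted as stated (false at d ∈ {1, 3}): see \
  Literature.AlgebraicGeometry.Motives.not_exists_cmWeilSurface_aimedSplitProduct \
  (AimedSplitProductRefutation.lean, p115551); corrected statement: \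
  Literature.AlgebraicGeometry.Motives.exists_cmWeilSurface_aimedSplitProduct_of_ne_one_of_ne_three \
  (this file, guard d ≠ 1 → d ≠ 3 →)" (since := "2026-08-16")]
def exists_cmWeilSurface_aimedSplitProduct : Prop :=
  ∀ d : ℕ, 0 < d →
    ∃ (B : AbelianVariety ℂ) (ψ : B ⟶ B), B.dim = 2 ∧ ψ ≫ ψ = -((d : ℤ) • 𝟙 B) ∧
      (∃ bp bm η : complexBetti B.X 2,
        bp ∈ Module.End.eigenspace (complexBetti.map (𝟙 B + ψ).hom.hom.hom 2).hom
              ((1 + Complex.I * (Real.sqrt (d : ℝ) : ℂ)) ^ 2) ∧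
        bm ∈ Module.End.eigenspace (complexBetti.map (𝟙 B + ψ).hom.hom.hom 2).hom
              ((1 - Complex.I * (Real.sqrt (d : ℝ) : ℂ)) ^ 2) ∧
        IsRationalClass (bp + bm) ∧ IsOfHodgeType 2 B.X 2 1 1 (bp + bm) ∧
        η ∈ algebraicClasses B.X 1 ∧
        cupProduct (show 2 + 2 = 4 from rfl) bp η ≠ 0 ∧
        cupProduct (show 2 + 2 = 4 from rfl) bm η ≠ 0) ∧
      ∀ (n : ℕ) (A : AbelianVariety ℂ) (φ : A ⟶ A), A.dim = 2 * n → φ ≫ φ = -((d : ℤ) • 𝟙 A) →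
        (∃ c : complexBetti A.X (2 * n), c ≠ 0 ∧ IsRationalClass c ∧
          IsOfHodgeType (2 * n) A.X (2 * n) n n c ∧
          c ∈ Module.End.eigenspace (complexBetti.map (𝟙 A + φ).hom.hom.hom (2 * n)).hom
                ((1 + Complex.I * (Real.sqrt (d : ℝ) : ℂ)) ^ (2 * n)) ⊔
              Module.End.eigenspace (complexBetti.map (𝟙 A + φ).hom.hom.hom (2 * n)).hom
                ((1 - Complex.I * (Real.sqrt (d : ℝ) : ℂ)) ^ (2 * n))) →
        ∃ (e : ProjectiveEmbedding (A.prod B).X) (a : complexBetti (projectiveSpace e.n ℂ) 2),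
          IsRationalClass a ∧ a ≠ 0 ∧
          IsHyperbolicWeilType (A.prod B)
            (AbelianVariety.prodLift (AbelianVariety.fst A B ≫ φ) (AbelianVariety.snd A B ≫ ψ))
            (n + 1)
            ((d : ℂ) • complexBetti.map e.ι 2 a +
              complexBetti.map (AbelianVariety.prodLift (AbelianVariety.fst A B ≫ φ)
                (AbelianVariety.snd A B ≫ ψ)).hom.hom.hom 2 (complexBetti.map e.ι 2 a))

/-- **Deprecated with the refuted record (vacuous: its hypothesis is refuted by
`Motives.not_exists_cmWeilSurface_aimedSplitProduct`).** Unfolding the (refuted) record at a given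
`d > 0` (definitional). Use `exists_cmWeilSurface_aimedSplitProduct_of_ne_one_of_ne_three.at`.
[cite: Markman2025SurveySecant, §11.5 Step 2] -/
@[deprecated "vacuous (hypothesis refuted): use \
  Literature.AlgebraicGeometry.Motives.exists_cmWeilSurface_aimedSplitProduct_of_ne_one_of_ne_three.at"
  (since := "2026-08-16")]
theorem exists_cmWeilSurface_aimedSplitProduct.at (h : exists_cmWeilSurface_aimedSplitProduct)
    {d : ℕ} (hd : 0 < d) :
    ∃ (B : AbelianVariety ℂ) (ψ : B ⟶ B), B.dim = 2 ∧ ψ ≫ ψ = -((d : ℤ) • 𝟙 B) ∧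
      (∃ bp bm η : complexBetti B.X 2,
        bp ∈ Module.End.eigenspace (complexBetti.map (𝟙 B + ψ).hom.hom.hom 2).hom
              ((1 + Complex.I * (Real.sqrt (d : ℝ) : ℂ)) ^ 2) ∧
        bm ∈ Module.End.eigenspace (complexBetti.map (𝟙 B + ψ).hom.hom.hom 2).hom
              ((1 - Complex.I * (Real.sqrt (d : ℝ) : ℂ)) ^ 2) ∧
        IsRationalClass (bp + bm) ∧ IsOfHodgeType 2 B.X 2 1 1 (bp + bm) ∧
        η ∈ algebraicClasses B.X 1 ∧
        cupProduct (show 2 + 2 = 4 from rfl) bp η ≠ 0 ∧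
        cupProduct (show 2 + 2 = 4 from rfl) bm η ≠ 0) ∧
      ∀ (n : ℕ) (A : AbelianVariety ℂ) (φ : A ⟶ A), A.dim = 2 * n → φ ≫ φ = -((d : ℤ) • 𝟙 A) →
        (∃ c : complexBetti A.X (2 * n), c ≠ 0 ∧ IsRationalClass c ∧
          IsOfHodgeType (2 * n) A.X (2 * n) n n c ∧
          c ∈ Module.End.eigenspace (complexBetti.map (𝟙 A + φ).hom.hom.hom (2 * n)).hom
                ((1 + Complex.I * (Real.sqrt (d : ℝ) : ℂ)) ^ (2 * n)) ⊔
              Module.End.eigenspace (complexBetti.map (𝟙 A + φ).hom.hom.hom (2 * n)).hom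
                ((1 - Complex.I * (Real.sqrt (d : ℝ) : ℂ)) ^ (2 * n))) →
        ∃ (e : ProjectiveEmbedding (A.prod B).X) (a : complexBetti (projectiveSpace e.n ℂ) 2),
          IsRationalClass a ∧ a ≠ 0 ∧
          IsHyperbolicWeilType (A.prod B)
            (AbelianVariety.prodLift (AbelianVariety.fst A B ≫ φ) (AbelianVariety.snd A B ≫ ψ))
            (n + 1)
            ((d : ℂ) • complexBetti.map e.ι 2 a +
              complexBetti.map (AbelianVariety.prodLift (AbelianVariety.fst A B ≫ φ)
                (AbelianVariety.snd A B ≫ ψ)).hom.hom.hom 2 (complexBetti.map e.ι 2 a)) :=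
  h d hd

/-! ### The eigenvalue collisions behind the misstatement -/

/-- **The `d = 3` collision of the single test endomorphism `(𝟙 + φ)^*`**: with `ζ = (1-i√3)/(1+i√3)`
a primitive cube root of unity, the character of `(𝟙+φ)^*` on `V₊ ⊗ ⋀³V₋ ⊆ H⁴` equals its character on
the Weil line `⋀⁴V₊`: `(1+i√3)·(1-i√3)³ = (1+i√3)⁴` (`= 16 e^{-2πi/3}`). Hence for `d = 3`, `n ≥ 2` the
eigenspace `Eig((𝟙+φ)^*, (1+i√3)^{2n})` is larger than the Weil line (module docstring,
`## Misstatement`). [folklore] -/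
theorem weilTestCharacter_collision_three :
    ((1 : ℂ) + Complex.I * (Real.sqrt 3 : ℂ)) * (1 - Complex.I * (Real.sqrt 3 : ℂ)) ^ 3 =
      (1 + Complex.I * (Real.sqrt 3 : ℂ)) ^ 4 := by
  have h3 : ((Real.sqrt 3 : ℝ) : ℂ) ^ 2 = 3 := by
    rw [← Complex.ofReal_pow, Real.sq_sqrt (by norm_num : (0 : ℝ) ≤ 3)]; norm_num
  have hI : Complex.I ^ 2 = -1 := Complex.I_sq
  linear_combination ((1 + Complex.I * (Real.sqrt 3 : ℂ)) * (-2 * (Complex.I * (Real.sqrt 3 : ℂ))) *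
      (Real.sqrt 3 : ℂ) ^ 2) * hI +
    ((1 + Complex.I * (Real.sqrt 3 : ℂ)) * (2 * (Complex.I * (Real.sqrt 3 : ℂ)))) * h3

/-- **The `d = 1` collision of the single test endomorphism `(𝟙 + φ)^*`** (`√1 = 1`,
`ζ = (1-i)/(1+i) = -i` of order `4`): the character on `⋀²V₊ ⊗ ⋀⁴V₋ ⊆ H⁶` equals the character on the
Weil line `⋀⁶V₊`: `(1+i)²·(1-i)⁴ = (1+i)⁶` (`= -8i`). Hence for `d = 1`, `n ≥ 3` the eigenspace
`Eig((𝟙+φ)^*, (1+i)^{2n})` is larger than the Weil line. [folklore] -/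
theorem weilTestCharacter_collision_one :
    ((1 : ℂ) + Complex.I) ^ 2 * (1 - Complex.I) ^ 4 = (1 + Complex.I) ^ 6 := by
  have hI : Complex.I ^ 2 = -1 := Complex.I_sq
  linear_combination ((1 + Complex.I) ^ 2 * (-8 * Complex.I)) * hI

/-! ### The balanced collisions (the simplest counterexamples, `(d, n) = (3, 3)` and `(1, 4)`)

When `ζⁿ = 1` the Weil test eigenvalue `(1+i√d)^{2n}` equals the character `(1+d)ⁿ` of `(𝟙+φ)^*` on
the BALANCED summand `⋀ⁿV₊ ⊗ ⋀ⁿV₋` and is a rational integer; for `φ = ρ^{×2n}` on `E^{2n}`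
(`ρ = [√-d]`, multiplicities `(2n, 0)`) that summand is all of `H^{n,n}`, so every rational `(n,n)`-class
— e.g. the class of `ptⁿ × Eⁿ`, on which `(𝟙+φ)^* = ((𝟙+ρ)^*)^{⊗2n}` acts by `deg(𝟙+ρ)ⁿ = (1+d)ⁿ` — is
a witness of the hypothesis of `exists_cmWeilSurface_aimedSplitProduct` on an abelian variety that is
not of Weil type (module docstring, `## Misstatement`, simplest counterexamples). -/

/-- **The balanced `d = 3` collision**: `(1+i√3)³·(1-i√3)³ = 4³ = (1+i√3)⁶` — at `(d, n) = (3, 3)` the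
character of `(𝟙+φ)^*` on `⋀³V₊ ⊗ ⋀³V₋ ⊆ H⁶` equals the Weil character. [folklore] -/
theorem weilTestCharacter_collision_three_balanced :
    ((1 : ℂ) + Complex.I * (Real.sqrt 3 : ℂ)) ^ 3 * (1 - Complex.I * (Real.sqrt 3 : ℂ)) ^ 3 =
      (1 + Complex.I * (Real.sqrt 3 : ℂ)) ^ 6 := by
  have h3 : ((Real.sqrt 3 : ℝ) : ℂ) ^ 2 = 3 := by
    rw [← Complex.ofReal_pow, Real.sq_sqrt (by norm_num : (0 : ℝ) ≤ 3)]; norm_num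
  have ha : (Complex.I * (Real.sqrt 3 : ℂ)) ^ 2 = -3 := by rw [mul_pow, Complex.I_sq, h3]; norm_num
  set a : ℂ := Complex.I * (Real.sqrt 3 : ℂ)
  linear_combination (-2 * a ^ 4 - 6 * a ^ 3 - 6 * a ^ 2 - 2 * a) * ha

/-- **`(1 + i√3)⁶ = 64 = 4³ = deg(𝟙 + [√-3])³`**: at `(d, n) = (3, 3)` the Weil test eigenvalue is a
rational integer, the degree of the isogeny `(𝟙 + ρ)^{×3}`. [folklore] -/
theorem weilTestCharacter_pow_six_three : ((1 : ℂ) + Complex.I * (Real.sqrt 3 : ℂ)) ^ 6 = 64 := by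
  have h3 : ((Real.sqrt 3 : ℝ) : ℂ) ^ 2 = 3 := by
    rw [← Complex.ofReal_pow, Real.sq_sqrt (by norm_num : (0 : ℝ) ≤ 3)]; norm_num
  have ha : (Complex.I * (Real.sqrt 3 : ℂ)) ^ 2 = -3 := by rw [mul_pow, Complex.I_sq, h3]; norm_num
  set a : ℂ := Complex.I * (Real.sqrt 3 : ℂ)
  linear_combination (a ^ 4 + 6 * a ^ 3 + 12 * a ^ 2 + 2 * a - 21) * ha

/-- **The balanced `d = 1` collision**: `(1+i)⁴·(1-i)⁴ = 2⁴ = (1+i)⁸` — at `(d, n) = (1, 4)` the character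
of `(𝟙+φ)^*` on `⋀⁴V₊ ⊗ ⋀⁴V₋ ⊆ H⁸` equals the Weil character. [folklore] -/
theorem weilTestCharacter_collision_one_balanced :
    ((1 : ℂ) + Complex.I) ^ 4 * (1 - Complex.I) ^ 4 = (1 + Complex.I) ^ 8 := by
  have hI : Complex.I ^ 2 = -1 := Complex.I_sq
  linear_combination
    (-8 * Complex.I ^ 5 - 32 * Complex.I ^ 4 - 48 * Complex.I ^ 3 - 32 * Complex.I ^ 2 -
      8 * Complex.I) * hI

/-- **`(1 + i)⁸ = 16 = 2⁴ = deg(𝟙 + [i])⁴`**: at `(d, n) = (1, 4)` the Weil test eigenvalue is a rational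
integer. [folklore] -/
theorem weilTestCharacter_pow_eight_one : ((1 : ℂ) + Complex.I) ^ 8 = 16 := by
  have hI : Complex.I ^ 2 = -1 := Complex.I_sq
  linear_combination
    (Complex.I ^ 6 + 8 * Complex.I ^ 5 + 27 * Complex.I ^ 4 + 48 * Complex.I ^ 3 +
      43 * Complex.I ^ 2 + 8 * Complex.I - 15) * hI

/-! ### The corrected statement (as the conclusion of a proved implication) -/

/-- **Deprecated with the refuted record (vacuous: its hypothesis is refuted by
`Motives.not_exists_cmWeilSurface_aimedSplitProduct`); the corrected statement itself is the named
fact `exists_cmWeilSurface_aimedSplitProduct_of_ne_one_of_ne_three`.**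
**The corrected statement of the aiming lemma, verbatim, as a CONCLUSION.** The product trick
(Markman §11.5 Step 2; van Geemen Lemma 5.2, 5.3–5.8, 5.4 (5.4.1); Schoen §10) in the typing of this
file is a true statement exactly under the guard `d ≠ 1`, `d ≠ 3` (module docstring
`## Misstatement`): for such `d` the eigenspaces `Eig((𝟙+φ)^*, (1 ± i√d)^{2n})` are the Weil lines
`⋀^{2n}V±`, a non-zero rational `(n,n)`-class in their span exists iff the `K`-multiplicities are
`(n, n)` (van Geemen 5.2 (6)), and then: `B = E × E`, `E = ℂ/O_K`, `ψ = (√-d) × (-√-d)` with the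
descent pair `b₊ ∝ dz₁∧dz̄₂`, `b₋ ∝ dz̄₁∧dz₂`, `η = [Δ_E]`; for `(A, φ, E_A)` polarized of Weil type with
`det H_A = (-1)ⁿ q`, the `K`-compatible polarization `E_A ⊞ (m₁E₀ ⊞ m₂E₀)` with `-m₁m₂r₁r₂ ≡ (-1)/q`
has `det H = (-1)^{n+1}` (multiplicativity, van Geemen 5.2 (3)), hence Witt index `n + 1` (Landherr,
5.4 (5.4.1)), i.e. `IsHyperbolicWeilType` for the hyperplane class `h = 3·c₁(E_A ⊞ m₁E₀ ⊞ m₂E₀)`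
of the Lefschetz embedding (`d·h + (φ×ψ)^*h = 2d·h`). This theorem records that corrected statement
as a Lean term — since re-filed verbatim as the named fact
`exists_cmWeilSurface_aimedSplitProduct_of_ne_one_of_ne_three` (second part of this file) — and
proves only the trivial direction: it follows from the original (unguarded, false at `d ∈ {1,3}`)
typing by specialisation. It is NOT a discharge of anything (its hypothesis is a false statement).
[cite: Markman2025SurveySecant, §11.5 Step 2]
[cite: vanGeemen1994HodgeAV, Lemma 5.2 (2)–(6), 5.3–5.8 and 5.4 (5.4.1)]
[cite: Schoen1998HodgeWeilAddendum, §10 (proof of the Proposition)] -/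
@[deprecated "vacuous (hypothesis refuted): the corrected statement is the named fact \
  Literature.AlgebraicGeometry.Motives.exists_cmWeilSurface_aimedSplitProduct_of_ne_one_of_ne_three"
  (since := "2026-08-16")]
theorem exists_cmWeilSurface_aimedSplitProduct.of_ne_one_of_ne_three
    (h : exists_cmWeilSurface_aimedSplitProduct) :
    ∀ d : ℕ, 0 < d → d ≠ 1 → d ≠ 3 →
    ∃ (B : AbelianVariety ℂ) (ψ : B ⟶ B), B.dim = 2 ∧ ψ ≫ ψ = -((d : ℤ) • 𝟙 B) ∧
      (∃ bp bm η : complexBetti B.X 2,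
        bp ∈ Module.End.eigenspace (complexBetti.map (𝟙 B + ψ).hom.hom.hom 2).hom
              ((1 + Complex.I * (Real.sqrt (d : ℝ) : ℂ)) ^ 2) ∧
        bm ∈ Module.End.eigenspace (complexBetti.map (𝟙 B + ψ).hom.hom.hom 2).hom
              ((1 - Complex.I * (Real.sqrt (d : ℝ) : ℂ)) ^ 2) ∧
        IsRationalClass (bp + bm) ∧ IsOfHodgeType 2 B.X 2 1 1 (bp + bm) ∧
        η ∈ algebraicClasses B.X 1 ∧
        cupProduct (show 2 + 2 = 4 from rfl) bp η ≠ 0 ∧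
        cupProduct (show 2 + 2 = 4 from rfl) bm η ≠ 0) ∧
      ∀ (n : ℕ) (A : AbelianVariety ℂ) (φ : A ⟶ A), A.dim = 2 * n → φ ≫ φ = -((d : ℤ) • 𝟙 A) →
        (∃ c : complexBetti A.X (2 * n), c ≠ 0 ∧ IsRationalClass c ∧
          IsOfHodgeType (2 * n) A.X (2 * n) n n c ∧
          c ∈ Module.End.eigenspace (complexBetti.map (𝟙 A + φ).hom.hom.hom (2 * n)).hom
                ((1 + Complex.I * (Real.sqrt (d : ℝ) : ℂ)) ^ (2 * n)) ⊔
              Module.End.eigenspace (complexBetti.map (𝟙 A + φ).hom.hom.hom (2 * n)).hom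
                ((1 - Complex.I * (Real.sqrt (d : ℝ) : ℂ)) ^ (2 * n))) →
        ∃ (e : ProjectiveEmbedding (A.prod B).X) (a : complexBetti (projectiveSpace e.n ℂ) 2),
          IsRationalClass a ∧ a ≠ 0 ∧
          IsHyperbolicWeilType (A.prod B)
            (AbelianVariety.prodLift (AbelianVariety.fst A B ≫ φ) (AbelianVariety.snd A B ≫ ψ))
            (n + 1)
            ((d : ℂ) • complexBetti.map e.ι 2 a +
              complexBetti.map (AbelianVariety.prodLift (AbelianVariety.fst A B ≫ φ)
                (AbelianVariety.snd A B ≫ ψ)).hom.hom.hom 2 (complexBetti.map e.ι 2 a)) :=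
  fun d hd _ _ => h d hd

end Literature.AlgebraicGeometry.Motives

/-! ## Relocated from `Summits/HodgeConjecture/HodgeConjecture/Theorems/HeckePrymWeilAimedDescendingOfFacts.lean` (gate, accept-time relocation of cited facts) — Markman2025SurveySecant, Schoen1998HodgeWeilAddendum, vanGeemen1994HodgeAV -/

namespace Literature.AlgebraicGeometry.Motives

open scoped Manifold
open CategoryTheory
open Literature.AlgebraicGeometry Literature.AlgebraicGeometry.HodgeTheory
open Literature.AlgebraicTopology.SingularHomology

/-- **Aimed split products with the CM Weil surface — the aiming lemma of the product trick, in
the polarised carrier typing, for `K = ℚ(√-d)`, `d ≠ 1, 3`.** For every `d > 0` with `d ≠ 1`,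
`d ≠ 3` there is a complex abelian SURFACE `B` with an endomorphism `ψ`, `ψ ≫ ψ = -d` — in print
`B = E × E`, `E = ℂ/O_K`, `K` acting through `(ι, ῑ)`, of Weil type `(1,1)` — carrying a DESCENT
PAIR: classes `b₊ ∈ Eig((𝟙+ψ)^*, (1+i√d)²)`, `b₋ ∈ Eig((𝟙+ψ)^*, (1-i√d)²)` in `H²(B(ℂ); ℂ)` with
`b₊ + b₋` rational of Hodge type `(1,1)` and an algebraic class `η ∈ N¹H²(B(ℂ); ℂ)` with
`b₊ ⌣ η ≠ 0`, `b₋ ⌣ η ≠ 0` in `H⁴(B(ℂ); ℂ)` (Schoen: "`W_{A'}` is generated by cohomology classes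
of divisors" and "`ω_{5,σ₁} ∧ ω_{6,σ₁} ∧ ω_{5,σ₂} ∧ ω_{6,σ₂}` is a basis for `H⁴(A'; ℂ)`"; here
`η = [Δ_E]`), such that for every `n` and every complex abelian `2n`-fold `(A, φ)` with
`φ ≫ φ = -d` which is of Weil type — witnessed by a non-zero rational `(n,n)`-class in its Weil
span `Eig((𝟙+φ)^*, (1+i√d)^{2n}) ⊔ Eig((𝟙+φ)^*, (1-i√d)^{2n})` (for `d ≠ 1, 3` these eigenspaces
are the Weil lines `⋀^{2n}V±`, the quotient `(1-i√d)/(1+i√d)` being no root of unity, and such a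
class exists iff the `K`-multiplicities are `(n, n)`, van Geemen 5.2 (6)) — the product `A × B`
has a projective embedding `e` and a rational class `a ≠ 0` of `H²(ℙᴺ(ℂ); ℂ)` for which
`(A × B, φ × ψ)` is of HYPERBOLIC (split) Weil type in half-dimension `n + 1` for the
`K`-symmetrised hyperplane class `d·e.ι^*a + (φ × ψ)^*e.ι^*a` (`Motives.IsHyperbolicWeilType`: a
`(φ×ψ)^*`-stable rational Lagrangian `(2n+2)`-frame of `H¹`, i.e. Witt index `n + 1`,
`det H = (-1)^{n+1} ∈ ℚ^×/Nm(K^×)`). Printed for fourfolds `A` by Markman (arXiv:2509.23403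
§11.5 Step 2: "for every polarized abelian fourfold `(A₁,η₁,h₁)` of Weil type, of arbitrary
discriminant, there exists a polarized abelian surface of Weil type `(A₂,η₂,h₂)`, such that the
discriminant of their product polarized abelian sixfold of Weil type
`(A₁ × A₂, η, π₁^*h₁ + π₂^*h₂)` is the coset of `-1`. The sixfold is hence of split type"); in
every dimension it is van Geemen's Lemma 5.2 (3) (`det H` is multiplicative under orthogonal
sums), 5.3 (on `E × E` every class `-q`, `q ∈ ℚ_{>0}`, is the discriminant of a `K`-compatible
polarisation `m₁E₁ ⊕ m₂E₁`) and 5.4 (5.4.1) (Landherr: signature `(n+1, n+1)` and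
`det H = (-1)^{n+1}` force Witt index `n + 1`), read through the dictionary `Q_h = c·E^*·vol` on
`H* = ⋀*H¹` of `Motives/HyperbolicWeilType`; the embedding is Segre ∘ (an embedding of `A` ×
Veronese-weighted embeddings of the two factors of `B`). This is VERBATIM the corrected statement
recorded in `Literature/AlgebraicGeometry/Motives/AimedSplitProduct` (`## Misstatement`: the
unguarded `Motives.exists_cmWeilSurface_aimedSplitProduct` is false at `d ∈ {1, 3}`, where the
single test endomorphism `(𝟙+φ)^*` has eigenvalue collisions — refuted by
`Motives.not_exists_cmWeilSurface_aimedSplitProduct`, retired and `@[deprecated]` since 2026-08-16),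
i.e. the conclusion of the (deprecated, vacuous) specialisation
`Motives.exists_cmWeilSurface_aimedSplitProduct.of_ne_one_of_ne_three`.
-- TODO(general form): any imaginary quadratic `K` and any CM elliptic curve `E` with `O_K ⊆ End E`,
-- Weil type rendered by `HodgeTheory.weilClassesOf` (no guard on `d`).
[cite: Markman2025SurveySecant, §11.5 Step 2] [cite: vanGeemen1994HodgeAV, Lemma 5.2 (3), 5.3 and 5.4 (5.4.1)]
[cite: Schoen1998HodgeWeilAddendum, §10 (proof of the Proposition)]
[file AlgebraicGeometry/Motives/AimedSplitProduct] -/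
def exists_cmWeilSurface_aimedSplitProduct_of_ne_one_of_ne_three : Prop :=
  ∀ d : ℕ, 0 < d → d ≠ 1 → d ≠ 3 →
    ∃ (B : Motives.AbelianVariety ℂ) (ψ : B ⟶ B), B.dim = 2 ∧ ψ ≫ ψ = -((d : ℤ) • 𝟙 B) ∧
      (∃ bp bm η : complexBetti B.X 2,
        bp ∈ Module.End.eigenspace (complexBetti.map (𝟙 B + ψ).hom.hom.hom 2).hom
              ((1 + Complex.I * (Real.sqrt (d : ℝ) : ℂ)) ^ 2) ∧
        bm ∈ Module.End.eigenspace (complexBetti.map (𝟙 B + ψ).hom.hom.hom 2).hom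
              ((1 - Complex.I * (Real.sqrt (d : ℝ) : ℂ)) ^ 2) ∧
        IsRationalClass (bp + bm) ∧ IsOfHodgeType 2 B.X 2 1 1 (bp + bm) ∧
        η ∈ algebraicClasses B.X 1 ∧
        cupProduct (show 2 + 2 = 4 from rfl) bp η ≠ 0 ∧
        cupProduct (show 2 + 2 = 4 from rfl) bm η ≠ 0) ∧
      ∀ (n : ℕ) (A : Motives.AbelianVariety ℂ) (φ : A ⟶ A), A.dim = 2 * n →
        φ ≫ φ = -((d : ℤ) • 𝟙 A) →
        (∃ c : complexBetti A.X (2 * n), c ≠ 0 ∧ IsRationalClass c ∧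
          IsOfHodgeType (2 * n) A.X (2 * n) n n c ∧
          c ∈ Module.End.eigenspace (complexBetti.map (𝟙 A + φ).hom.hom.hom (2 * n)).hom
                ((1 + Complex.I * (Real.sqrt (d : ℝ) : ℂ)) ^ (2 * n)) ⊔
              Module.End.eigenspace (complexBetti.map (𝟙 A + φ).hom.hom.hom (2 * n)).hom
                ((1 - Complex.I * (Real.sqrt (d : ℝ) : ℂ)) ^ (2 * n))) →
        ∃ (e : Motives.ProjectiveEmbedding (A.prod B).X)
          (a : complexBetti (Motives.projectiveSpace e.n ℂ) 2),
          IsRationalClass a ∧ a ≠ 0 ∧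
          Motives.IsHyperbolicWeilType (A.prod B)
            (Motives.AbelianVariety.prodLift (Motives.AbelianVariety.fst A B ≫ φ)
              (Motives.AbelianVariety.snd A B ≫ ψ))
            (n + 1)
            ((d : ℂ) • complexBetti.map e.ι 2 a +
              complexBetti.map (Motives.AbelianVariety.prodLift (Motives.AbelianVariety.fst A B ≫ φ)
                (Motives.AbelianVariety.snd A B ≫ ψ)).hom.hom.hom 2 (complexBetti.map e.ι 2 a))

/-- **Deprecated with the refuted record (vacuous: its hypothesis is refuted by
`Motives.not_exists_cmWeilSurface_aimedSplitProduct`).** **Original (unguarded) typing ⇒ corrected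
fact**: the bundled form of the specialisation
`exists_cmWeilSurface_aimedSplitProduct.of_ne_one_of_ne_three` — the corrected fact is literally the
misstated one under the guard `d ≠ 1 → d ≠ 3 →`. NOT a discharge: the hypothesis is the misstated
(refuted) record, false at `d ∈ {1, 3}` (`## Misstatement` of the module docstring).
[cite: Markman2025SurveySecant, §11.5 Step 2] -/
@[deprecated "vacuous (hypothesis refuted): no substitute — discharge \
  Literature.AlgebraicGeometry.Motives.exists_cmWeilSurface_aimedSplitProduct_of_ne_one_of_ne_three directly"
  (since := "2026-08-16")]
theorem exists_cmWeilSurface_aimedSplitProduct_of_ne_one_of_ne_three.of_unguarded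
    (h : exists_cmWeilSurface_aimedSplitProduct) :
    exists_cmWeilSurface_aimedSplitProduct_of_ne_one_of_ne_three :=
  fun d hd h1 h3 => exists_cmWeilSurface_aimedSplitProduct.of_ne_one_of_ne_three h d hd h1 h3

/-- Unfolding the corrected fact at a given `d > 0`, `d ≠ 1`, `d ≠ 3` (definitional).
[cite: Markman2025SurveySecant, §11.5 Step 2] -/
theorem exists_cmWeilSurface_aimedSplitProduct_of_ne_one_of_ne_three.at
    (h : exists_cmWeilSurface_aimedSplitProduct_of_ne_one_of_ne_three) {d : ℕ} (hd : 0 < d)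
    (h1 : d ≠ 1) (h3 : d ≠ 3) :
    ∃ (B : Motives.AbelianVariety ℂ) (ψ : B ⟶ B), B.dim = 2 ∧ ψ ≫ ψ = -((d : ℤ) • 𝟙 B) ∧
      (∃ bp bm η : complexBetti B.X 2,
        bp ∈ Module.End.eigenspace (complexBetti.map (𝟙 B + ψ).hom.hom.hom 2).hom
              ((1 + Complex.I * (Real.sqrt (d : ℝ) : ℂ)) ^ 2) ∧
        bm ∈ Module.End.eigenspace (complexBetti.map (𝟙 B + ψ).hom.hom.hom 2).hom
              ((1 - Complex.I * (Real.sqrt (d : ℝ) : ℂ)) ^ 2) ∧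
        IsRationalClass (bp + bm) ∧ IsOfHodgeType 2 B.X 2 1 1 (bp + bm) ∧
        η ∈ algebraicClasses B.X 1 ∧
        cupProduct (show 2 + 2 = 4 from rfl) bp η ≠ 0 ∧
        cupProduct (show 2 + 2 = 4 from rfl) bm η ≠ 0) ∧
      ∀ (n : ℕ) (A : Motives.AbelianVariety ℂ) (φ : A ⟶ A), A.dim = 2 * n →
        φ ≫ φ = -((d : ℤ) • 𝟙 A) →
        (∃ c : complexBetti A.X (2 * n), c ≠ 0 ∧ IsRationalClass c ∧
          IsOfHodgeType (2 * n) A.X (2 * n) n n c ∧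
          c ∈ Module.End.eigenspace (complexBetti.map (𝟙 A + φ).hom.hom.hom (2 * n)).hom
                ((1 + Complex.I * (Real.sqrt (d : ℝ) : ℂ)) ^ (2 * n)) ⊔
              Module.End.eigenspace (complexBetti.map (𝟙 A + φ).hom.hom.hom (2 * n)).hom
                ((1 - Complex.I * (Real.sqrt (d : ℝ) : ℂ)) ^ (2 * n))) →
        ∃ (e : Motives.ProjectiveEmbedding (A.prod B).X)
          (a : complexBetti (Motives.projectiveSpace e.n ℂ) 2),
          IsRationalClass a ∧ a ≠ 0 ∧
          Motives.IsHyperbolicWeilType (A.prod B)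
            (Motives.AbelianVariety.prodLift (Motives.AbelianVariety.fst A B ≫ φ)
              (Motives.AbelianVariety.snd A B ≫ ψ))
            (n + 1)
            ((d : ℂ) • complexBetti.map e.ι 2 a +
              complexBetti.map (Motives.AbelianVariety.prodLift (Motives.AbelianVariety.fst A B ≫ φ)
                (Motives.AbelianVariety.snd A B ≫ ψ)).hom.hom.hom 2 (complexBetti.map e.ι 2 a)) :=
  h d hd h1 h3

end Literature.AlgebraicGeometry.Motives

/-! ## No other collisions: `(1-i√d)/(1+i√d)` is a root of unity only for `d ∈ {1, 3}`

The module docstring (`## Misstatement`) asserts that the two eigenspaces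
`Eig((𝟙+φ)^*, (1 ± i√d)^{2n})` used by the fact to render "Weil type" are EXACTLY the Weil lines
`⋀^{2n}V±` when `d ∉ {1, 3}`, because the character `(1+i√d)ᵃ(1-i√d)ᵇ` of `(𝟙+φ)^*` on
`⋀ᵃV₊ ⊗ ⋀ᵇV₋` equals `(1+i√d)^{a+b}` only for `b = 0` — i.e. `ζ = (1-i√d)/(1+i√d)` is not a root of
unity. The two collision theorems above give the "if" at `d = 3`, `d = 1`; the three theorems below
prove the "only if" for every other `d > 0` (the arithmetic half of the eigenspace identification the
discharge of `exists_cmWeilSurface_aimedSplitProduct_of_ne_one_of_ne_three` needs). Proof: a root of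
unity `ζ` is an algebraic integer, hence so is `ζ + ζ⁻¹ = 2(1-d)/(1+d) ∈ ℚ`, which must then be a
rational integer `m`; but `(m + 2)(d + 1) = 4` forces `d + 1 ∣ 4`, `d ∈ {0, 1, 3}`. -/

namespace Literature.AlgebraicGeometry.Motives

/-- **`ζ = (1-i√d)/(1+i√d)` is not a root of unity for `0 < d`, `d ≠ 1`, `d ≠ 3`**:
`(1 - i√d)ᵏ ≠ (1 + i√d)ᵏ` for every `k ≥ 1`. (If `ζᵏ = 1` then `ζ` and `ζ⁻¹ = ζ^{k-1}` are
integral over `ℤ`, so the rational number `ζ + ζ⁻¹ = 2(1-d)/(1+d)` is an integer `m`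
(`ℤ` is integrally closed), and `(m+2)(d+1) = 4` gives `d + 1 ∣ 4`, i.e. `d ∈ {0, 1, 3}`.) The
converse collisions are `weilTestCharacter_collision_three/one`. [folklore] -/
theorem weilTestCharacter_pow_ne_pow {d : ℕ} (hd : 0 < d) (h1 : d ≠ 1) (h3 : d ≠ 3) {k : ℕ}
    (hk : 0 < k) :
    (1 - Complex.I * (Real.sqrt (d : ℝ) : ℂ)) ^ k ≠ (1 + Complex.I * (Real.sqrt (d : ℝ) : ℂ)) ^ k := by
  intro h
  set s : ℂ := (Real.sqrt (d : ℝ) : ℂ) with hs_def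
  have hs : s ^ 2 = (d : ℂ) := by
    rw [hs_def, ← Complex.ofReal_pow, Real.sq_sqrt (Nat.cast_nonneg d), Complex.ofReal_natCast]
  have hI : Complex.I ^ 2 = -1 := Complex.I_sq
  have h1d : (1 + (d : ℂ)) ≠ 0 := by
    have : ((1 + d : ℕ) : ℂ) ≠ 0 := Nat.cast_ne_zero.2 (by omega)
    simpa using this
  have hab : (1 + Complex.I * s) * (1 - Complex.I * s) = 1 + d := by
    linear_combination (-s ^ 2) * hI + hs
  have ha0 : (1 + Complex.I * s) ≠ 0 := by
    intro h0; apply h1d; rw [← hab, h0, zero_mul]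
  have hb0 : (1 - Complex.I * s) ≠ 0 := by
    intro h0; apply h1d; rw [← hab, h0, mul_zero]
  set ζ : ℂ := (1 - Complex.I * s) / (1 + Complex.I * s) with hζ_def
  have hζk : ζ ^ k = 1 := by
    rw [hζ_def, div_pow, h, div_self (pow_ne_zero _ ha0)]
  -- `ζ` and `ζ⁻¹ = ζ^{k-1}` are algebraic integers, hence so is `ζ + ζ⁻¹`
  have hint : IsIntegral ℤ ζ := IsIntegral.of_pow hk (by rw [hζk]; exact isIntegral_one)
  have hinv : ζ⁻¹ = ζ ^ (k - 1) := by
    have : ζ ^ (k - 1) * ζ = 1 := by rw [← pow_succ, Nat.sub_add_cancel hk, hζk]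
    exact (eq_inv_of_mul_eq_one_left this).symm
  have ht : IsIntegral ℤ (ζ + ζ⁻¹) := hint.add (by rw [hinv]; exact hint.pow _)
  -- `ζ + ζ⁻¹ = 2(1-d)/(1+d)` is rational
  have hq : ζ + ζ⁻¹ = algebraMap ℚ ℂ (2 * (1 - d) / (1 + d)) := by
    rw [hζ_def, inv_div, div_add_div _ _ ha0 hb0, div_eq_iff (mul_ne_zero ha0 hb0)]
    simp only [map_div₀, map_mul, map_sub, map_add, map_one, map_natCast, map_ofNat]
    rw [div_mul_eq_mul_div, eq_div_iff h1d]
    linear_combination (4 * s ^ 2) * hI - 4 * hs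
  rw [hq] at ht
  have hqint : IsIntegral ℤ ((2 * (1 - d) / (1 + d) : ℚ)) :=
    (isIntegral_algebraMap_iff (algebraMap ℚ ℂ).injective).1 ht
  -- hence an integer `m`, with `(m + 2)(d + 1) = 4`
  obtain ⟨m, hm⟩ := IsIntegrallyClosed.isIntegral_iff.1 hqint
  have h1dQ : (1 + (d : ℚ)) ≠ 0 := by positivity
  have hmQ : (m : ℚ) * (1 + d) = 2 * (1 - d) := by
    rw [eq_div_iff h1dQ] at hm
    simpa using hm
  have hZ : (m + 2) * ((d : ℤ) + 1) = 4 := by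
    have h' : ((m + 2) * ((d : ℤ) + 1) : ℚ) = 4 := by push_cast; linear_combination hmQ
    exact_mod_cast h'
  have hle : (d : ℤ) + 1 ≤ 4 :=
    Int.le_of_dvd (by norm_num) ⟨m + 2, by rw [mul_comm]; exact hZ.symm⟩
  have hd3 : d ≤ 3 := by omega
  interval_cases d
  · exact h1 rfl
  · omega
  · exact h3 rfl

/-- **No collision with the `+` Weil character for `d ∉ {1, 3}`**: if the character
`(1+i√d)ᵃ(1-i√d)ᵇ` of the test endomorphism `(𝟙+φ)^*` on `⋀ᵃV₊ ⊗ ⋀ᵇV₋ ⊆ H^{a+b}` equals its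
character `(1+i√d)^{a+b}` on the Weil line `⋀^{a+b}V₊`, then `b = 0`. Hence for `0 < d`, `d ≠ 1, 3`
the eigenspace `Eig((𝟙+φ)^*, (1+i√d)^{2n}) ⊆ H^{2n}(A(ℂ); ℂ) = ⊕_{a+b=2n} ⋀ᵃV₊ ⊗ ⋀ᵇV₋` is the Weil
line `⋀^{2n}V₊` alone (module docstring, `## Misstatement`). [folklore] -/
theorem weilTestCharacter_eq_pow_add_iff_right {d : ℕ} (hd : 0 < d) (h1 : d ≠ 1) (h3 : d ≠ 3)
    {a b : ℕ} :
    (1 + Complex.I * (Real.sqrt (d : ℝ) : ℂ)) ^ a * (1 - Complex.I * (Real.sqrt (d : ℝ) : ℂ)) ^ b =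
        (1 + Complex.I * (Real.sqrt (d : ℝ) : ℂ)) ^ (a + b) ↔ b = 0 := by
  refine ⟨fun h => ?_, fun hb => by rw [hb, pow_zero, mul_one, add_zero]⟩
  by_contra hb
  have ha0 : (1 + Complex.I * (Real.sqrt (d : ℝ) : ℂ)) ≠ 0 := by
    intro h0
    have := congrArg Complex.re h0
    simp at this
  refine weilTestCharacter_pow_ne_pow hd h1 h3 (Nat.pos_of_ne_zero hb) ?_
  rw [pow_add] at h
  exact mul_left_cancel₀ (pow_ne_zero _ ha0) h

/-- **No collision with the `-` Weil character for `d ∉ {1, 3}`**: if `(1+i√d)ᵃ(1-i√d)ᵇ = (1-i√d)^{a+b}`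
then `a = 0`; hence `Eig((𝟙+φ)^*, (1-i√d)^{2n}) = ⋀^{2n}V₋` for `0 < d`, `d ≠ 1, 3`. [folklore] -/
theorem weilTestCharacter_eq_pow_add_iff_left {d : ℕ} (hd : 0 < d) (h1 : d ≠ 1) (h3 : d ≠ 3)
    {a b : ℕ} :
    (1 + Complex.I * (Real.sqrt (d : ℝ) : ℂ)) ^ a * (1 - Complex.I * (Real.sqrt (d : ℝ) : ℂ)) ^ b =
        (1 - Complex.I * (Real.sqrt (d : ℝ) : ℂ)) ^ (a + b) ↔ a = 0 := by
  refine ⟨fun h => ?_, fun ha => by rw [ha, pow_zero, one_mul, zero_add]⟩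
  by_contra ha
  have hb0 : (1 - Complex.I * (Real.sqrt (d : ℝ) : ℂ)) ≠ 0 := by
    intro h0
    have := congrArg Complex.re h0
    simp at this
  refine weilTestCharacter_pow_ne_pow hd h1 h3 (Nat.pos_of_ne_zero ha) ?_
  rw [pow_add] at h
  exact (mul_right_cancel₀ (pow_ne_zero _ hb0) h).symm

end Literature.AlgebraicGeometry.Motives
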